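import Summits.BirchSwinnertonDyer.BirchSwinnertonDyer.Theorems.ManinLocalTwoThreeAdditiveDyadicTransport
import Literature.NumberTheory.EllipticCurves.ModularSymbolsProofs
import HarnessLib

/-!
# E-an-80: a `t`-FIXED cusp maps to `E[2]` (symbol level) — an g18 LEMMA, kernel-checked (hand-over from the cell typer, landed by prover p3 g6 with the `N = 20` witness inlined — no definitions)

Cell `bsd-f2-manin`, seat -an g18 (MEMO-an §60.2), HOME/an/Sketch-an-g18.lean sha16 46abb1fbb5651cc7 §1 VERBATIM
(namespace `…Cruxes.ManinOddAtFour.HalfTranslation` ↦ `…Theorems.ManinLocalTwoThree`; refuter-1 §R59 re-checked,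
axioms standard).  If `4 ∣ N`, the even coefficients of `f` vanish, and the cusp `r` is `t`-FIXED on `X₀(N)` —
witnessed by `γ ∈ Γ₀(N)` with `γ r = r + 1/2` — then `2 {∞, r}_f ∈ Λ_f`, i.e. `φ(r) ∈ E[2]`: Manin's relation
`{∞, γ r}_f = {∞, γ∞}_f + {∞, r}_f` (`modularSymbol_gamma0_smul_holds`) and the half-translate lemma
`{∞, r + 1/2}_f = −{∞, r}_f` (`maninLocalTwoThree_modularSymbol_add_half_eq_neg_of_four_dvd`) give
`2 {∞, r}_f = −{∞, γ∞}_f`.  Instance at `N = 20` with `γ₂₀ = (−29 8; −40 11)`: `2 {∞, 1/4}_f ∈ Λ_f`.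
This lemma is NOT in the `ManinAdditive/HalfTranslationParity.lean` leaf (typer T-an-23) because its only available
proof route imports this `Theorems/` module, whose cone contains the route `Theses` file; it belongs here.
Nothing about BSD or Manin's conjecture is asserted or proved.
-/

set_option autoImplicit false
set_option linter.dupNamespace false

noncomputable section

open scoped MatrixGroups ModularForm
open CongruenceSubgroup
open Literature.NumberTheory.EllipticCurves Literature.NumberTheory.EllipticCurves.ModularForms

namespace Summit.BirchSwinnertonDyer.BirchSwinnertonDyer.Theorems.ManinLocalTwoThree

/-- **E-an-80 (LEMMA, an g18; kernel-checked).**  If `4 ∣ N`, the even coefficients of `f` vanish, and the cusp `r` is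
`t`-FIXED on `X₀(N)` — witnessed by `γ ∈ Γ₀(N)` with `γ r = r + 1/2` — then `2 {∞, r}_f ∈ Λ_f`, i.e. `φ(r) ∈ E[2]`.
[cite: Manin1972, §1.2 (Manin's relation for `{∞, γ r}`)] [cite: Cremona1997, §2.8] -/
theorem two_mul_modularSymbol_mem_periodLattice_of_halfFixed {N : ℕ} [NeZero N]
    (f : CuspForm (Gamma0 N) 2) (h4 : 4 ∣ N) (heven : ∀ n : ℕ, 2 ∣ n → cuspCoeff f n = 0)
    (γ : Gamma0 N) (r : ℚ)
    (hden : ((γ : SL(2, ℤ)) 1 0 : ℚ) * r + ((γ : SL(2, ℤ)) 1 1 : ℚ) ≠ 0)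
    (hfix : (((γ : SL(2, ℤ)) 0 0 : ℚ) * r + ((γ : SL(2, ℤ)) 0 1 : ℚ)) /
        (((γ : SL(2, ℤ)) 1 0 : ℚ) * r + ((γ : SL(2, ℤ)) 1 1 : ℚ)) = r + 1 / 2) :
    (2 : ℂ) * modularSymbol f r ∈ periodLattice f := by
  have h1 := modularSymbol_gamma0_smul_holds f γ r hden
  rw [hfix, maninLocalTwoThree_modularSymbol_add_half_eq_neg_of_four_dvd f h4 heven r] at h1
  have h2 : (2 : ℂ) * modularSymbol f r = -cuspSymbol f γ := by linear_combination -h1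
  rw [h2]
  exact (periodLattice f).neg_mem (cuspSymbol_mem_periodLattice f γ)

/-- **Instance at `N = 20` (kernel-checked):** for every `f ∈ S₂(Γ₀(20))` with vanishing even coefficients,
`2 {∞, 1/4}_f ∈ Λ_f` — the quarter symbol is a half-period (census: `φ₀(1/4) = (−1, 0) = T` on `20a1`).
[cite: Cremona1997, §2.8] -/
theorem two_mul_quarterSymbol_mem_periodLattice_twenty (f : CuspForm (Gamma0 20) 2)
    (heven : ∀ n : ℕ, 2 ∣ n → cuspCoeff f n = 0) :
    (2 : ℂ) * modularSymbol f (1 / 4 : ℚ) ∈ periodLattice f := by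
  -- the witness `γ₂₀ = (−29 8; −40 11) ∈ Γ₀(20)`: `det = 1`, lower-left `≡ 0 (mod 20)`, `γ₂₀ (1/4) = 3/4 = 1/4 + 1/2`
  -- (general `N = 4M`, `M` odd: `(1−6M, (3M+1)/2; −8M, 2M+1)`)
  let γM : SL(2, ℤ) := ⟨!![-29, 8; -40, 11], by rw [Matrix.det_fin_two_of]; norm_num⟩
  have hγM : γM ∈ Gamma0 20 := Gamma0_mem.mpr (by simp [γM]; decide)
  have h00 : (((⟨γM, hγM⟩ : Gamma0 20) : SL(2, ℤ)) 0 0 : ℤ) = -29 := rfl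
  have h01 : (((⟨γM, hγM⟩ : Gamma0 20) : SL(2, ℤ)) 0 1 : ℤ) = 8 := rfl
  have h10 : (((⟨γM, hγM⟩ : Gamma0 20) : SL(2, ℤ)) 1 0 : ℤ) = -40 := rfl
  have h11 : (((⟨γM, hγM⟩ : Gamma0 20) : SL(2, ℤ)) 1 1 : ℤ) = 11 := rfl
  exact two_mul_modularSymbol_mem_periodLattice_of_halfFixed f (by norm_num) heven ⟨γM, hγM⟩ (1 / 4)
    (by rw [h10, h11]; norm_num) (by rw [h00, h01, h10, h11]; norm_num)

end Summit.BirchSwinnertonDyer.BirchSwinnertonDyer.Theorems.ManinLocalTwoThree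

end
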